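import Literature.AlgebraicGeometry.Morphisms.FormalModuleCompletion
import Literature.AlgebraicGeometry.Morphisms.FormalFunctionsModuleCokernel
import HarnessLib

/-!
# Morphisms of completions with free source come from morphisms of modules (GW II Cor. 24.100)

Görtz–Wedhorn, *Algebraic Geometry II* (2023), Prop. 24.99 / Cor. 24.100 (pp. 568–569): for `X`
proper over an `I`-adically complete noetherian ring `A` and coherent `ℱ`, `𝒢`, completion induces
a bijection `Hom(ℱ, 𝒢) ≅ Hom(ℱ_{/Z}, 𝒢_{/Z})`. This file proves the case of a FREE source in the tower
language of `Morphisms/FormalModuleTower` / `Morphisms/FormalModuleCompletion` (towers along the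
global function `a|_X = algebraMapΓ f a`, completion `cmplTower`, `cmplMap`):

* `cmplIsoModPow` — the dictionary `(M/aⁿ⁺¹M as a level of cmplTower) ≅ modPow f M a (n+1)` with
  the levels of `Morphisms/FormalFunctionsModuleComplete`, compatible with the quotient and
  transition maps;
* `existsUnique_cmplMap_free` — **every morphism of towers `cmplTower (𝒪_X^{(I)}) → cmplTower G`
  (`G` coherent) is `cmplMap v` for a unique `v : 𝒪_X^{(I)} → G`**: its levels form a compatible
  family `𝒪_X^{(I)} → G/aᵏG`, to which `existsUnique_freeHom_of_compatible` (Thm. 24.37 for modules,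
  `toFormalSectionsModule_bijective`) applies.

Everything is proved; no named facts.

## References

* U. Görtz, T. Wedhorn, *Algebraic Geometry II: Cohomology of Schemes*, Springer Spektrum (2023),
  Prop. 24.99, Cor. 24.100 (pp. 568–569). [GortzWedhorn2023]
* A. Grothendieck, EGA III₁ (1961), 5.1.3. [EGAIII1]
-/

noncomputable section

open CategoryTheory AlgebraicGeometry Limits TopologicalSpace Opposite
open Literature.AlgebraicGeometry.Modules

universe u

namespace Literature.AlgebraicGeometry.Morphisms

variable {A : Type u} [CommRing A] {X : Scheme.{u}} (f : X ⟶ Spec (.of A)) (a : A)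

/-! ### The dictionary between `cmplTower (a|_X) M` and `modPow f M a` -/

section Dictionary

variable (M : X.Modules)

/-- `(a|_X)ᵏ = (aᵏ)|_X`. [folklore] -/
theorem algebraMapΓ_pow_eq (k : ℕ) : algebraMapΓ f a ^ k = algebraMapΓ f (a ^ k) :=
  (map_pow _ _ _).symm

/-- **`M/(a|_X)ⁿ⁺¹M ≅ modPow f M a (n+1)`** (the same cokernel, of equal morphisms). [folklore] -/
def cmplIsoModPow (n : ℕ) : cmplObj (algebraMapΓ f a) M n ≅ modPow f M a (n + 1) :=
  cokernelIsoOfEq (by rw [algebraMapΓ_pow_eq])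

/-- The quotient maps correspond. [folklore] -/
@[reassoc (attr := simp)]
theorem cmplπ_cmplIsoModPow_hom (n : ℕ) :
    cmplπ (algebraMapΓ f a) M n ≫ (cmplIsoModPow f a M n).hom = modPowπ f M a (n + 1) :=
  π_comp_cokernelIsoOfEq_hom _

/-- The quotient maps correspond (inverse direction). [folklore] -/
@[reassoc (attr := simp)]
theorem modPowπ_cmplIsoModPow_inv (n : ℕ) :
    modPowπ f M a (n + 1) ≫ (cmplIsoModPow f a M n).inv = cmplπ (algebraMapΓ f a) M n :=
  π_comp_cokernelIsoOfEq_inv _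

/-- The transition maps correspond. [folklore] -/
@[reassoc]
theorem cmplStep_cmplIsoModPow_hom (n : ℕ) :
    cmplStep (algebraMapΓ f a) M n ≫ (cmplIsoModPow f a M n).hom =
      (cmplIsoModPow f a M (n + 1)).hom ≫ modPowSucc f M a (n + 1) := by
  rw [← cancel_epi (cmplπ (algebraMapΓ f a) M (n + 1)), cmplπ_cmplStep_assoc,
    cmplπ_cmplIsoModPow_hom, cmplπ_cmplIsoModPow_hom_assoc, modPowπ_modPowSucc]

/-- The quotient map followed by the transition of `cmplTower` is the quotient map. [folklore] -/
theorem cmplπ_towerπ_cmplTower (b : Γ(X, ⊤)) (N : X.Modules) (n : ℕ) :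
    cmplπ b N (n + 1) ≫ towerπ (cmplTower b N) n = cmplπ b N n :=
  (congrArg (cmplπ b N (n + 1) ≫ ·) (towerπ_cmplTower b N n)).trans (cmplπ_cmplStep b N n)

/-- `modPow f G a 0 = G/G` is a zero object. [folklore] -/
theorem isZero_modPow_zero (G : X.Modules) : IsZero (modPow f G a 0) := by
  have h : globalScalar G (algebraMapΓ f (a ^ 0)) = 𝟙 G := by
    rw [pow_zero, map_one, globalScalar_one]
  haveI : Epi (globalScalar G (algebraMapΓ f (a ^ 0))) := by rw [h]; infer_instance
  exact isZero_cokernel_of_epi _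

end Dictionary

/-! ### Morphisms of towers out of a completion -/

section Lift

variable {P G : X.Modules}

/-- The family `P → G/aᵏG` attached to a morphism of towers `cmplTower P → cmplTower G` (zero in
degree `0`, where `G/a⁰G = 0`). [folklore] -/
def levelFamily (w : cmplTower (algebraMapΓ f a) P ⟶ cmplTower (algebraMapΓ f a) G) :
    ∀ k, P ⟶ modPow f G a k
  | 0 => 0
  | n + 1 => cmplπ (algebraMapΓ f a) P n ≫ w.app ⟨n⟩ ≫ (cmplIsoModPow f a G n).hom

/-- The positive levels of `levelFamily`. [folklore] -/
theorem levelFamily_succ (w : cmplTower (algebraMapΓ f a) P ⟶ cmplTower (algebraMapΓ f a) G) (n : ℕ) :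
    levelFamily f a w (n + 1) = cmplπ (algebraMapΓ f a) P n ≫ w.app ⟨n⟩ ≫ (cmplIsoModPow f a G n).hom :=
  rfl

/-- Naturality of a morphism of completion towers with respect to the transition maps `cmplStep`.
[folklore] -/
@[reassoc]
theorem app_cmplStep (w : cmplTower (algebraMapΓ f a) P ⟶ cmplTower (algebraMapΓ f a) G) (n : ℕ) :
    w.app ⟨n + 1⟩ ≫ cmplStep (algebraMapΓ f a) G n = cmplStep (algebraMapΓ f a) P n ≫ w.app ⟨n⟩ := by
  have h := towerπ_naturality w n
  simp only [towerπ_cmplTower] at h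
  exact h

/-- The family is compatible with the transition maps. [folklore] -/
theorem levelFamily_compatible (w : cmplTower (algebraMapΓ f a) P ⟶ cmplTower (algebraMapΓ f a) G) :
    ∀ k, levelFamily f a w (k + 1) ≫ modPowSucc f G a k = levelFamily f a w k
  | 0 => (isZero_modPow_zero f a G).eq_of_tgt _ _
  | n + 1 => by
    -- term-mode bookkeeping (the unifier of `rw` is too weak on these goals)
    have e1 : (cmplIsoModPow f a G (n + 1)).hom ≫ modPowSucc f G a (n + 1) =
        cmplStep (algebraMapΓ f a) G n ≫ (cmplIsoModPow f a G n).hom :=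
      (cmplStep_cmplIsoModPow_hom f a G n).symm
    have e2 := app_cmplStep f a w n
    have e3 := cmplπ_cmplStep (algebraMapΓ f a) P n
    exact calc (cmplπ _ P (n + 1) ≫ w.app ⟨n + 1⟩ ≫ (cmplIsoModPow f a G (n + 1)).hom) ≫
          modPowSucc f G a (n + 1)
        = cmplπ _ P (n + 1) ≫ w.app ⟨n + 1⟩ ≫ (cmplIsoModPow f a G (n + 1)).hom ≫
            modPowSucc f G a (n + 1) :=
          (Category.assoc _ _ _).trans (congrArg _ (Category.assoc _ _ _))
      _ = cmplπ _ P (n + 1) ≫ w.app ⟨n + 1⟩ ≫ cmplStep _ G n ≫ (cmplIsoModPow f a G n).hom :=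
          congrArg (fun t => cmplπ _ P (n + 1) ≫ w.app ⟨n + 1⟩ ≫ t) e1
      _ = cmplπ _ P (n + 1) ≫ (w.app ⟨n + 1⟩ ≫ cmplStep _ G n) ≫ (cmplIsoModPow f a G n).hom :=
          congrArg (cmplπ _ P (n + 1) ≫ ·) (Category.assoc _ _ _).symm
      _ = cmplπ _ P (n + 1) ≫ (cmplStep _ P n ≫ w.app ⟨n⟩) ≫ (cmplIsoModPow f a G n).hom :=
          congrArg (fun t => cmplπ _ P (n + 1) ≫ t ≫ (cmplIsoModPow f a G n).hom) e2
      _ = (cmplπ _ P (n + 1) ≫ cmplStep _ P n) ≫ w.app ⟨n⟩ ≫ (cmplIsoModPow f a G n).hom :=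
          (congrArg (cmplπ _ P (n + 1) ≫ ·) (Category.assoc _ _ _)).trans (Category.assoc _ _ _).symm
      _ = cmplπ _ P n ≫ w.app ⟨n⟩ ≫ (cmplIsoModPow f a G n).hom := congrArg (· ≫ _) e3

/-- A morphism of completion towers is `cmplMap v` iff `v mod aᵏ` is its level family. [folklore] -/
theorem cmplMap_eq_iff (w : cmplTower (algebraMapΓ f a) P ⟶ cmplTower (algebraMapΓ f a) G) (v : P ⟶ G) :
    cmplMap (algebraMapΓ f a) v = w ↔ ∀ k, v ≫ modPowπ f G a k = levelFamily f a w k := by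
  constructor
  · intro h k
    cases k with
    | zero => exact (isZero_modPow_zero f a G).eq_of_tgt _ _
    | succ n =>
      have hw : w.app ⟨n⟩ = cmplMapApp (algebraMapΓ f a) v n := by rw [← h]; rfl
      have e1 := cmplπ_cmplMapApp (algebraMapΓ f a) v n
      have e2 := cmplπ_cmplIsoModPow_hom f a G n
      exact calc v ≫ modPowπ f G a (n + 1)
          = v ≫ cmplπ _ G n ≫ (cmplIsoModPow f a G n).hom := congrArg (v ≫ ·) e2.symm
        _ = (v ≫ cmplπ _ G n) ≫ (cmplIsoModPow f a G n).hom := (Category.assoc _ _ _).symm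
        _ = (cmplπ _ P n ≫ cmplMapApp (algebraMapΓ f a) v n) ≫ (cmplIsoModPow f a G n).hom :=
            congrArg (· ≫ _) e1.symm
        _ = cmplπ _ P n ≫ cmplMapApp (algebraMapΓ f a) v n ≫ (cmplIsoModPow f a G n).hom :=
            Category.assoc _ _ _
        _ = cmplπ _ P n ≫ w.app ⟨n⟩ ≫ (cmplIsoModPow f a G n).hom :=
            congrArg (fun t => cmplπ _ P n ≫ t ≫ (cmplIsoModPow f a G n).hom) hw.symm
  · intro h
    refine NatTrans.ext (funext fun k => ?_)
    obtain ⟨n⟩ := k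
    change cmplMapApp (algebraMapΓ f a) v n = w.app ⟨n⟩
    have e1 := cmplπ_cmplMapApp (algebraMapΓ f a) v n
    have e2 := cmplπ_cmplIsoModPow_hom f a G n
    have H : (cmplπ _ P n ≫ cmplMapApp (algebraMapΓ f a) v n) ≫ (cmplIsoModPow f a G n).hom =
        (cmplπ _ P n ≫ w.app ⟨n⟩) ≫ (cmplIsoModPow f a G n).hom :=
      calc (cmplπ _ P n ≫ cmplMapApp (algebraMapΓ f a) v n) ≫ (cmplIsoModPow f a G n).hom
          = (v ≫ cmplπ _ G n) ≫ (cmplIsoModPow f a G n).hom := congrArg (· ≫ _) e1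
        _ = v ≫ cmplπ _ G n ≫ (cmplIsoModPow f a G n).hom := Category.assoc _ _ _
        _ = v ≫ modPowπ f G a (n + 1) := congrArg (v ≫ ·) e2
        _ = cmplπ _ P n ≫ w.app ⟨n⟩ ≫ (cmplIsoModPow f a G n).hom := h (n + 1)
        _ = (cmplπ _ P n ≫ w.app ⟨n⟩) ≫ (cmplIsoModPow f a G n).hom := (Category.assoc _ _ _).symm
    exact (cancel_epi _).mp ((cancel_mono _).mp H)

/-- **Morphisms of towers `cmplTower P → cmplTower G` come from a unique `P → G`** as soon as
compatible families `P → G/aᵏG` lift uniquely to `P → G` (e.g. `P` free and `G` coherent on a proper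
`X` over a complete noetherian `A`, `existsUnique_freeHom_of_compatible`). [cite: GortzWedhorn2023, Cor. 24.100 (p. 569)] -/
theorem existsUnique_cmplMap_of_lift
    (hP : ∀ (w' : ∀ k, P ⟶ modPow f G a k), (∀ k, w' (k + 1) ≫ modPowSucc f G a k = w' k) →
      ∃! v : P ⟶ G, ∀ k, v ≫ modPowπ f G a k = w' k)
    (w : cmplTower (algebraMapΓ f a) P ⟶ cmplTower (algebraMapΓ f a) G) :
    ∃! v : P ⟶ G, cmplMap (algebraMapΓ f a) v = w := by
  obtain ⟨v, hv, huniq⟩ := hP (levelFamily f a w) (levelFamily_compatible f a w)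
  exact ⟨v, (cmplMap_eq_iff f a w v).mpr hv, fun v' hv' => huniq v' ((cmplMap_eq_iff f a w v').mp hv')⟩

end Lift

/-! ### Free sources -/

/-- **Morphisms of towers `cmplTower 𝒪_X^{(I)} → cmplTower G` come from a unique `𝒪_X^{(I)} → G`**
(`X` proper over a noetherian `a`-adically complete `A`, `G` coherent): GW II Cor. 24.100 for a free
source, in the tower language. [cite: GortzWedhorn2023, Cor. 24.100 (p. 569)] -/
theorem existsUnique_cmplMap_free [IsNoetherianRing A] [IsProper f] [IsAdicComplete (Ideal.span {a}) A]
    {I : Type u} {G : X.Modules} (hG : Coh G)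
    (w : cmplTower (algebraMapΓ f a) (SheafOfModules.free I : X.Modules) ⟶ cmplTower (algebraMapΓ f a) G) :
    ∃! v : (SheafOfModules.free I : X.Modules) ⟶ G, cmplMap (algebraMapΓ f a) v = w :=
  existsUnique_cmplMap_of_lift f a
    (fun w' hw' => existsUnique_freeHom_of_compatible f a hG w' hw') w

end Literature.AlgebraicGeometry.Morphisms

end
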